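/-
Origin: expansion seat `planner-pub-hodgecm-pv13-g3-0`, handover #8 v2 2026-08-18T07:31:19Z (`HOME/pub-hodgecm-pv13-g3/lean/Pv13g3/RallisAdic.lean`, md5 142ada81, 167 lines);
landed by the gen-7 packager in gate run 26 as `HodgeCM/PerL34/RallisAdic.lean` (import ^import Pv13g3\.→import HodgeCM.PerL34. ×1; import ^import Pv[0-9]+g[0-9]+\.→import HodgeCM.PerL34. ×1).
-/
/-
Copyright: HodgeCM publication cell (pub-hodgecm), DAG node N31h (seam S3) — JOINT of the global chain
N31d ⟹ N31e ⟹ (I) ⟹ N31g/N31h (pv09-g4 `RallisHaar`) with the per-place inputs over the completions (this seat,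
`PlaceInputs`).  Prover seat pv13-g3 (DAG-NODE PROVER #13, generation 3), file #8.  Released under the package licence.

# `θ_φ(χ′) ≠ 0` from node N31d's print inputs and PER-PLACE DEFINITIONAL DATA ONLY

pv09-g4's `PureTensor.theta_ne_zero_of_N31d` / `PureTensor.thetaLift_ne_zero_of_N31d` (RallisHaar, run 25) take, on
the representation side, the four per-place binders `X : UnramifiedPlaceData …`, `hclS`, `hsum`, `ram_pos`.  This
leaf substitutes the four PRODUCERS of `SplitShells.PlaceInputs` (#7): the result is Lemma 4.2(b)'s conclusion
`Θ(χ′) ≠ 0` for the genuine theta lift with, per place `v`, ONLY identification / choice / level / D4-dictionary /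
isotypy inputs (listed in #6 `theta_ne_zero_levels_adic_all`), and globally ONLY node N31d's print inputs
(pv15 `GluePrintInputs`, pv05 `DoublingDatum` / `hP`), the rational set-up (`jA`, `j`, fundamental domain `𝓕` —
pv09-g4's `RallisHaarDomain` produces `𝓕`), the levels `K_T`, `K_{T′}` with local continuity, the pure-tensor
product formula `hM`, and the measurability / boundedness of the theta kernel.
Source under adjudication (NOT cited): PerL v5 Lemma 4.2(b), ll. 542–635.  Nothing cited, nothing asserted; complete
proofs; axioms = the standard trio (log in the handover).
-/
import Summits.HodgeConjecture.HodgeCM.PerL34.RallisHaar_2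
import Summits.HodgeConjecture.HodgeCM.PerL34.PlaceInputs

/-! PORT of `HodgeCM/PerL34/RallisAdic.lean` (HodgeCMPerL run 82) — verbatim mechanical port; provenance in the PORT header line. -/

noncomputable section

open MeasureTheory MeasureTheory.Measure Set Metric Function Complex ComplexConjugate
open scoped RestrictedProduct InnerProductSpace NNReal ENNReal

namespace HodgeCM.PerL34.SplitShells

open HodgeCM.PerL34.PureTensor HodgeCM.PerL34.AdelicFactorisation HodgeCM.PerL34.RestrictedMeasure
open HodgeCM.PerL34.NoSmallSubgroups HodgeCM.PerL34.EulerFactorisation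
open HodgeCM.PerL34.LocalFactors HodgeCM.PerL34.LocalFactors.DilationModel
open HodgeCM.PerL34.LocalModulus HodgeCM.PerL34.SplitPlaceDilation
open HodgeCM.PerL34.RallisIP HodgeCM.PerL34.Doubling HodgeCM.PerL34.N31d

attribute [local instance] LocalFactors.DilationModel.Adic.nontriviallyNormedField
  LocalFactors.DilationModel.Adic.properSpace

section n31dAdic

variable {ι : Type} {G : ι → Type} [∀ i, CommGroup (G i)] [∀ i, TopologicalSpace (G i)]
  [∀ i, IsTopologicalGroup (G i)] [∀ i, T2Space (G i)] [∀ i, SecondCountableTopology (G i)]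
  [∀ i, LocallyCompactSpace (G i)] [∀ i, MeasurableSpace (G i)] [∀ i, BorelSpace (G i)]
  [Countable ι] [DecidableEq ι]
  (B : ∀ i, Subgroup (G i)) (hBc : ∀ i, IsCompact (B i : Set (G i)))
  (hBo : ∀ i, IsOpen (B i : Set (G i))) (S₀ : Finset ι)
  {Sp : Type} [NormedAddCommGroup Sp] [InnerProductSpace ℂ Sp]
  {E : Type*} [NormedAddCommGroup E] [InnerProductSpace ℂ E]
  -- pv05's doubling datum over `A := Πʳ_i [G_i, B_i]` and pv15's `G_U`-side data (DATA, D4)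
  {L : Type} [Field L] [StarRing L] {W : Type} [AddCommGroup W] [Module L W]
  {H Sbox : Type} [Group H] [AddCommGroup Sbox] [Module ℂ Sbox]
  {h : W →ₗ⋆[L] W →ₗ[L] L} (hW : IsLine L W) (hh : Anisotropic h)
  (D : DoublingDatum (Πʳ j, [G j, B j]) H Sp Sbox) (GU : ThetaSide Sp Sbox)
  -- rational set-up
  [Countable (unitary L)] (jA : unitary L →* Πʳ j, [G j, B j]) (hjA : Function.Injective jA)
  (j : isomBox h →* H) (hj : ∀ d : unitary L, j ⟨iotaSnd d, iotaSnd_mem h d⟩ = D.ι (1, jA d))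
  {𝓕 : Set (Πʳ j, [G j, B j])} (h𝓕 : IsFundamentalDomain jA.range 𝓕 (haarDatum B hBc hBo S₀).μ)
  (χ : (Πʳ j, [G j, B j]) →* Circle) (hχΓ : ∀ d : unitary L, χ (jA d) = 1)
  (hχVΓ : ∀ d : unitary L, D.χV (jA d) = 1)
  -- N31d's print inputs (pv15 `GluePrintInputs`) and pv05's `hP`
  {hP : ∀ Ψ : Sbox, ∀ p ∈ (stabDelta L W).subgroupOf (isomBox h), ∀ x : H,
    D.fSW Ψ (j p * x) = D.fSW Ψ x}
  (P : GluePrintInputs D GU h j hP) (φ : Sp)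
  -- representation side: unit vector, LOCAL continuity, levels, pure-tensor product formula
  (hφ : ‖φ‖ = 1)
  (hloc : ∀ (i : ι) (v : Sp), Continuous fun g : G i => D.ω (RestrictedProduct.mulSingle B i g) v)
  {T' : Finset ι} (hχT' : RestrictedProduct.boxSubgroup B T' ≤ χ.ker)
  (hlocχ : ∀ i ∈ T', Continuous fun g : G i => χ (RestrictedProduct.mulSingle B i g))
  {T : Finset ι} (hK : ∀ k ∈ RestrictedProduct.boxSubgroup B T, D.ω k φ = φ)
  (hM : ∀ S : Finset ι, T ⊆ S → ∀ y : (i : ↥S) → G i,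
    inner ℂ φ (D.ω (extendOne B S y) φ) = ∏ i : ↥S, localCoeff B D.ω φ i (y i))
  {S : Finset ι} {IsSplit : ι → Prop} (hTS : T ⊆ S) (hT'S : T' ⊆ S)
  -- PER-PLACE DEFINITIONAL DATA over the completions `L_{0,v} = (w v).adicCompletion L₀` (#4–#7)
  (L₀ : Type) [Field L₀] [NumberField L₀]
  (w : ι → IsDedekindDomain.HeightOneSpectrum (NumberField.RingOfIntegers L₀))
  (hw : ∀ ⦃i j : ι⦄, i ∉ S → j ∉ S → w i = w j → i = j)
  [∀ i, MeasurableSpace ((w i).adicCompletion L₀)] [∀ i, BorelSpace ((w i).adicCompletion L₀)]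
  (ν : ∀ i, ((w i).adicCompletion L₀)ˣ →* Circle)
  -- `v ∉ S` non-split: `B_v = G_v`
  (hBi : ∀ i, i ∉ S → ¬IsSplit i → (B i : Set (G i)) = Set.univ)
  -- `v ∉ S` split: valuation, uniformizers, `ν_v` unramified, dictionary on `1_{𝒪_v³}` (the levels `fixed`/`unram` of
  -- #4–#7 are DERIVED below from `hK`/`hχT'` and `T, T′ ⊆ S`)
  (ord : ∀ i, G i →* Multiplicative ℤ) (ϖ : ∀ i, G i) (ϖF : ∀ i, ((w i).adicCompletion L₀)ˣ)
  (hϖF : ∀ i, i ∉ S → IsUniformizer (ϖF i))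
  (ord_ϖ : ∀ i, i ∉ S → IsSplit i → ord i (ϖ i) = Multiplicative.ofAdd 1)
  (ker_ord : ∀ i, i ∉ S → IsSplit i → ∀ g : G i, ord i g = 1 ↔ g ∈ B i)
  (hν : ∀ i, i ∉ S → IsSplit i → ∀ u : ((w i).adicCompletion L₀)ˣ,
    ‖(u : (w i).adicCompletion L₀)‖ = 1 → ν i u = 1)
  (coeff_eq : ∀ i, i ∉ S → IsSplit i → ∀ n : ℤ, localCoeff B D.ω φ i (ϖ i ^ n)
    = ⟪ballIndicator (Adic.muV L₀ (w i)) 0 1,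
        dilationRep (Adic.muV L₀ (w i)) (ν i) (ϖF i ^ n) (ballIndicator (Adic.muV L₀ (w i)) 0 1)⟫_ℂ)
  -- `v ∈ S` split: `τ_v`, the ball, `c_v`, "N large", dictionary on `1_D`
  (τ : ∀ i, i ∈ S → IsSplit i → (G i ≃ₜ* ((w i).adicCompletion L₀)ˣ))
  (x₀ : ∀ i, Fin 3 → (w i).adicCompletion L₀) (r cS : ι → ℝ)
  (hr : ∀ i ∈ S, IsSplit i → r i < ‖x₀ i‖) (hr0 : ∀ i ∈ S, IsSplit i → 0 < r i)
  (hcS : ∀ i ∈ S, IsSplit i → 0 < cS i)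
  (hνS : ∀ i ∈ S, IsSplit i → ∀ y : ((w i).adicCompletion L₀)ˣ,
    (y : (w i).adicCompletion L₀) ∈ U1 (x₀ i) (r i) → ν i y = 1)
  (hχS : ∀ i (hi : i ∈ S) (hs : IsSplit i), ∀ g : G i,
    ((τ i hi hs g : ((w i).adicCompletion L₀)ˣ) : (w i).adicCompletion L₀) ∈ U1 (x₀ i) (r i) →
      χ (RestrictedProduct.mulSingle B i g) = 1)
  (coeffS : ∀ i (hi : i ∈ S) (hs : IsSplit i), ∀ g : G i, localCoeff B D.ω φ i g
    = (cS i : ℂ) * ⟪ballIndicator (Adic.muV L₀ (w i)) (x₀ i) (r i),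
        dilationRep (Adic.muV L₀ (w i)) (ν i) (τ i hi hs g) (ballIndicator (Adic.muV L₀ (w i)) (x₀ i) (r i))⟫_ℂ)
  -- `v ∈ S` non-split: compact local group, isotypy of the chosen vector
  (hcpt : ∀ i ∈ S, ¬IsSplit i → CompactSpace (G i))
  (hiso : ∀ i ∈ S, ¬IsSplit i → ∀ g : G i, D.ω (RestrictedProduct.mulSingle B i g) φ
    = conj (((χ (RestrictedProduct.mulSingle B i g) : Circle) : ℂ)) • φ)

omit [∀ i, TopologicalSpace (G i)] [∀ i, IsTopologicalGroup (G i)] [∀ i, T2Space (G i)]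
  [∀ i, SecondCountableTopology (G i)]
  [∀ i, LocallyCompactSpace (G i)] [∀ i, MeasurableSpace (G i)] [∀ i, BorelSpace (G i)] [Countable ι] in
/-- The level `K_T` fixes `φ` (`hK`) and `T ⊆ S`: hence `B_v` fixes `φ` at every `v ∉ S` (tex l. 628 "K_v-fixed"). -/
theorem fixed_of_level (φ : Sp) (ω : (Πʳ j, [G j, B j]) →* (Sp ≃ₗᵢ[ℂ] Sp)) {T S : Finset ι}
    (hK : ∀ k ∈ RestrictedProduct.boxSubgroup B T, ω k φ = φ) (hTS : T ⊆ S) (IsSplit : ι → Prop) :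
    ∀ i, i ∉ S → IsSplit i → ∀ b : G i, b ∈ B i → ω (RestrictedProduct.mulSingle B i b) φ = φ :=
  fun _i hi _ _b hb => hK _ (RestrictedProduct.mulSingle_mem_boxSubgroup T (fun h => hi (hTS h)) hb)

omit [∀ i, TopologicalSpace (G i)] [∀ i, IsTopologicalGroup (G i)] [∀ i, T2Space (G i)]
  [∀ i, SecondCountableTopology (G i)]
  [∀ i, LocallyCompactSpace (G i)] [∀ i, MeasurableSpace (G i)] [∀ i, BorelSpace (G i)] [Countable ι] in
/-- The level `K_{T′} ≤ ker χ′` (`hχT'`) and `T′ ⊆ S`: hence `χ′_v` is unramified at every `v ∉ S` (tex l. 628). -/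
theorem unram_of_level {T' S : Finset ι} (hχT' : RestrictedProduct.boxSubgroup B T' ≤ χ.ker) (hT'S : T' ⊆ S)
    (IsSplit : ι → Prop) :
    ∀ i, i ∉ S → IsSplit i → ∀ b : G i, b ∈ B i → χ (RestrictedProduct.mulSingle B i b) = 1 :=
  fun _i hi _ _b hb =>
    MonoidHom.mem_ker.mp (hχT' (RestrictedProduct.mulSingle_mem_boxSubgroup T' (fun h => hi (hT'S h)) hb))

include hW hh hjA hj h𝓕 hχΓ hχVΓ P hφ hloc hχT' hlocχ hK hM hTS hT'S hw hBi hϖF ord_ϖ ker_ord hν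
  coeff_eq hr hr0 hcS hνS hχS coeffS hcpt hiso

/-- **`θ ≠ 0` from node N31d's print inputs and per-place DEFINITIONAL data** (pv09-g4
`theta_ne_zero_of_N31d` with `X`, `hclS`, `hsum`, `ram_pos` := the producers of `PlaceInputs`; the levels off `S`
from `hK`/`hχT'`). -/
theorem theta_ne_zero_of_N31d_adic (vol_ne_top : (haarDatum B hBc hBo S₀).μ 𝓕 ≠ ⊤) (θ : E) (Θ : Set E)
    (hθ : θ ∈ Θ)
    (hnorm : ⟪θ, θ⟫_ℂ = ∫ u in 𝓕, ∫ u' in 𝓕, ((χ u : Circle) : ℂ) * conj ((χ u' : Circle) : ℂ) *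
      thetaKernel D GU φ u u' ∂(haarDatum B hBc hBo S₀).μ ∂(haarDatum B hBc hBo S₀).μ) : θ ≠ 0 := by
  classical
  exact theta_ne_zero_of_N31d B hBc hBo S₀ hW hh D GU jA hjA j hj h𝓕 χ hχΓ hχVΓ P φ hφ hloc hχT' hlocχ hK hM
    (adicPlaceData B hBc hBo S₀ D.ω φ χ L₀ w ν hBi ord ϖ ϖF hϖF ord_ϖ ker_ord (fixed_of_level B φ D.ω hK hTS IsSplit)
      (unram_of_level B χ hχT' hT'S IsSplit) hν coeff_eq) hTS hT'S
    (integrable_localCoeff_S_adic B hBc hBo S₀ D.ω φ L₀ w ν τ x₀ r cS hr hr0 hνS coeffS hcpt hloc)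
    (summable_tOf_adic L₀ w ϖF hϖF hw) vol_ne_top θ Θ hθ hnorm
    (I_pos_S_adic B hBc hBo S₀ D.ω φ χ L₀ w ν τ x₀ r cS hr hr0 hνS coeffS hcpt hφ hcS hχS hiso)

/-- **Lemma 4.2(b)'s conclusion `Θ(χ′) ≠ 0` for the GENUINE THETA LIFT, from node N31d's print inputs and
per-place DEFINITIONAL data** (pv09-g4 `thetaLift_ne_zero_of_N31d` with the four per-place binders produced):
`θ_φ(χ′) := ∫_𝓕 θ_φ(·,u) χ′(u) du ∈ L²([G_U])` is non-zero. -/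
theorem thetaLift_ne_zero_of_N31d_adic [IsFiniteMeasure GU.μ]
    [IsFiniteMeasure (((haarDatum B hBc hBo S₀).μ).restrict 𝓕)]
    (hk : Measurable (Function.uncurry (thetaFn D GU φ))) {Ck : ℝ} (hCk : 0 ≤ Ck)
    (hkC : ∀ q u, ‖thetaFn D GU φ q u‖ ≤ Ck) :
    PeterssonFubini.theta GU.μ (((haarDatum B hBc hBo S₀).μ).restrict 𝓕) hk
      (measurable_coe_char B hBo χ hχT' hlocχ) hCk hkC (norm_coe_char_le χ) ≠ 0 := by
  classical
  exact thetaLift_ne_zero_of_N31d B hBc hBo S₀ hW hh D GU jA hjA j hj h𝓕 χ hχΓ hχVΓ P φ hφ hloc hχT' hlocχ hK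
    hM (adicPlaceData B hBc hBo S₀ D.ω φ χ L₀ w ν hBi ord ϖ ϖF hϖF ord_ϖ ker_ord (fixed_of_level B φ D.ω hK hTS IsSplit)
      (unram_of_level B χ hχT' hT'S IsSplit) hν coeff_eq) hTS
    hT'S (integrable_localCoeff_S_adic B hBc hBo S₀ D.ω φ L₀ w ν τ x₀ r cS hr hr0 hνS coeffS hcpt hloc)
    (summable_tOf_adic L₀ w ϖF hϖF hw)
    (I_pos_S_adic B hBc hBo S₀ D.ω φ χ L₀ w ν τ x₀ r cS hr hr0 hνS coeffS hcpt hφ hcS hχS hiso) hk hCk hkC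

end n31dAdic

end HodgeCM.PerL34.SplitShells

end
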